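import Summits.QuantumAdvantage.QuantumAdvantage.Theorems.LinnikCubicClassGroupsDegreeOnePrimesEscapeCubicSplittingPrimes
import Summits.QuantumAdvantage.QuantumAdvantage.Theorems.LinnikCubicClassGroupsDegreeOnePrimesEscapeQuarticS4Count
import Summits.QuantumAdvantage.QuantumAdvantage.Theorems.LinnikCubicClassGroupsDegreeOnePrimesEscapeCubicInertPrimeLemmas
import Summits.QuantumAdvantage.QuantumAdvantage.Theorems.LinnikCubicClassGroupsDegreeOnePrimesEscapeClassPNTDHRelativePointed
import HarnessLib

/-!
# Prime ideal theorems for the subfields of a Galois number field, uniformly in the degree `≤ n`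

Topic `Summits/QuantumAdvantage/QuantumAdvantage/Theorems`, cell B2b-1 (linnik-cubic), PART A (gen 9);
helper toward the crux `DegreeOnePrimesEscape` (stmt-QuantumAdvantage-11543) of route
`LinnikCubicClassGroups`.  HONEST FRAMING: the value of this file is a THEOREM (kernel-checked, GRH-free,
no hypothesis) — NOT summit progress.

The analytic inputs of the Chebotarev–Linnik theorem for Frobenius DIVISIONS
(`…DegreeOnePrimesEscapeChebotarevDivision.lean`), which counts primes through the Dedekind zeta
functions of ALL the subfields `N^{⟨σ^d⟩}` of a Galois `N` of degree `n` at once; they are the tree's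
class prime number theorems (`thetaClass_relative`, `chebyshevThetaIdeal_le_uniform`,
`chebyshevThetaIdeal_relative_at_realZero`) summed over the classes, with constants made UNIFORM over the
degrees `2 ≤ k ≤ n`:

* `chebyshevThetaIdeal_le_uniform_of_le` — `θ_F(x) ≤ (1+η)x` for `x ≥ Q_F^A`, `A = A(n, η)`;
* `chebyshevThetaIdeal_lower_dichotomy` — EITHER `θ_F(x) ≥ (1−η)x` for `x ≥ Q_F^A`, OR `ζ_F` has a real
  zero `β ∈ [3/4, 1)` with `θ_F(x) ≥ (1−η)(x − x^β/β)` for `x ≥ Q_F^A` (unconditional, Deuring–Heilbronn);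
* `chebyshevThetaIdeal_pointed_of_le` — at a real zero `β` of `ζ_F` with `1 − c/(log|d_F| + log 4) < β`:
  `|θ_F(x) − (x − x^β/β)| ≤ η (x − x^β/β)` for `x ≥ Q_F^A` (`c = c(n, η) > 0`);
* `chebyshevThetaIdeal_sub_degreeOneTheta_le_rpow` — the prime ideals of non-prime norm: `θ_F − θ¹_F ≤ x^{3/4}`
  for `x ≥ X₁(n)`;
* `rpow_div_le_of_le_window` — a real zero OUTSIDE the window `(1 − c/(log d + log 4), 1)` contributes
  `x^β/β ≤ η x` at `x = d^L`, `L ≥ L₀(c, η)`;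
* `degreeOneTheta_fixedField_ge_of_forall_mem` — the degree-one subfield: `θ¹_{N^G}(x) ≥ θ(x) − log|d_N|`.

References: J. Thorner, A. Zaman, Algebra Number Theory 13 (2019), Thm. 1.4 [ThornerZaman2019];
A. Weiss, J. reine angew. Math. 338 (1983), Thm. 5.2 [Weiss1983].
-/

noncomputable section

open scoped NumberField nonZeroDivisors
open Finset Real Ideal NumberField
open Literature.NumberTheory.NumberFields Literature.NumberTheory.LFunctions
  Literature.NumberTheory.LFunctions.NumberField

namespace Summit.QuantumAdvantage.QuantumAdvantage.Theorems.DegreeOnePrimesEscape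

/-! ### Uniform constants over the degrees `2 … n` -/

/-- **`θ_F(x) ≤ (1 + η) x` uniformly over the number fields of degree `2 ≤ [F:ℚ] ≤ n`**, for
`x ≥ Q_F^{A(n, η)}`. -/
theorem chebyshevThetaIdeal_le_uniform_of_le (n : ℕ) {η : ℝ} (hη : 0 < η) :
    ∃ A : ℝ, 1 ≤ A ∧ ∀ (F : Type) [Field F] [NumberField F], 1 < Module.finrank ℚ F →
      Module.finrank ℚ F ≤ n → ∀ x : ℝ, ThornerZaman.condQn F ^ A ≤ x →
        chebyshevThetaIdeal F x ≤ (1 + η) * x := by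
  have hdeg : ∀ m : ℕ, ∃ a : ℝ, 1 ≤ a ∧ (1 < m → ∀ (K : Type) [Field K] [NumberField K],
      Module.finrank ℚ K = m → ∀ x : ℝ, ThornerZaman.condQn K ^ a ≤ x →
        chebyshevThetaIdeal K x ≤ (1 + η) * x) := by
    intro m
    by_cases hm : 1 < m
    · obtain ⟨a, ha, h⟩ := chebyshevThetaIdeal_le_uniform m hm hη
      exact ⟨a, ha, fun _ => h⟩
    · exact ⟨1, le_rfl, fun h => absurd h hm⟩
  choose a ha hupa using hdeg
  set A : ℝ := ∑ m ∈ Finset.range (n + 1), a m with hA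
  have haA : ∀ m ≤ n, a m ≤ A := fun m hm =>
    Finset.single_le_sum (f := a) (fun i _ => le_trans zero_le_one (ha i))
      (Finset.mem_range.mpr (Nat.lt_succ_of_le hm))
  have hA1 : 1 ≤ A := le_trans (ha 0) (haA 0 (Nat.zero_le n))
  refine ⟨A, hA1, fun F _ _ hF hFn x hx => ?_⟩
  have hQ12 : (12 : ℝ) ≤ ThornerZaman.condQn F := ThornerZaman.twelve_le_condQn (K := F) hF
  have hQa : ThornerZaman.condQn F ^ a (Module.finrank ℚ F) ≤ x :=
    le_trans (Real.rpow_le_rpow_of_exponent_le (by linarith) (haA _ hFn)) hx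
  exact hupa _ hF F rfl x hQa

/-- **The lower-bound dichotomy, uniformly over the degrees `2 ≤ [F:ℚ] ≤ n`** (the class prime number
theorem with relative error `thetaClass_relative`, summed over the classes): for `x ≥ Q_F^{A(n, η)}`,
EITHER `θ_F(x) ≥ (1 − η) x`, OR `ζ_F` has a real zero `β ∈ [3/4, 1)` and `θ_F(x) ≥ (1 − η)(x − x^β/β)`.
Unconditional. [cite: ThornerZaman2019, Theorem 1.4] -/
theorem chebyshevThetaIdeal_lower_dichotomy (n : ℕ) {η : ℝ} (hη : 0 < η) :
    ∃ A : ℝ, 1 ≤ A ∧ ∀ (F : Type) [Field F] [NumberField F], 1 < Module.finrank ℚ F →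
      Module.finrank ℚ F ≤ n →
      (∀ x : ℝ, ThornerZaman.condQn F ^ A ≤ x → (1 - η) * x ≤ chebyshevThetaIdeal F x) ∨
      ∃ β : ℝ, dedekindZeta₁ F β = 0 ∧ 3 / 4 ≤ β ∧ β < 1 ∧
        ∀ x : ℝ, ThornerZaman.condQn F ^ A ≤ x → (1 - η) * (x - x ^ β / β) ≤ chebyshevThetaIdeal F x := by
  classical
  have hdeg : ∀ m : ℕ, ∃ a : ℝ, 1 ≤ a ∧ (1 < m → ∀ (K : Type) [Field K] [NumberField K],
      Module.finrank ℚ K = m →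
      (∀ x : ℝ, ThornerZaman.condQn K ^ a ≤ x → (1 - η) * x ≤ chebyshevThetaIdeal K x) ∨
      ∃ β : ℝ, dedekindZeta₁ K β = 0 ∧ 3 / 4 ≤ β ∧ β < 1 ∧
        ∀ x : ℝ, ThornerZaman.condQn K ^ a ≤ x →
          (1 - η) * (x - x ^ β / β) ≤ chebyshevThetaIdeal K x) := by
    intro m
    by_cases hm : 1 < m
    · obtain ⟨a₂, c, ha₂, hc, hcn, hrel⟩ := thetaClass_relative m hm hη
      refine ⟨a₂, ha₂, fun _ K _ _ hK => ?_⟩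
      rcases hrel K hK with h1 | ⟨χ₁, β, hχreal, hβlo, hβ1, hLβ, h2⟩
      · left
        intro x hx
        exact chebyshevThetaIdeal_ge_of_classBound K (η := η) (x := x) (M := x) (fun C ↦ h1 x hx C)
      · by_cases hχ1 : χ₁ = 1
        · right
          subst hχ1
          have hm2 : (2 : ℝ) ≤ m := by exact_mod_cast hm
          have hβ34 : 3 / 4 ≤ β := by
            have hlog4 : 1 < Real.log 4 := by
              rw [show (4:ℝ) = 2 ^ 2 by norm_num, Real.log_pow]; have := Real.log_two_gt_d9; push_cast; linarith
            have hlogd : 0 ≤ Real.log ((NumberField.discr K).natAbs : ℝ) := Real.log_natCast_nonneg _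
            have hc4 : c ≤ 1 / 4 :=
              hcn.trans (by rw [div_le_div_iff_of_pos_left one_pos (by positivity) (by norm_num)]; nlinarith)
            have : c / (Real.log ((NumberField.discr K).natAbs : ℝ) + Real.log 4) ≤ 1 / 4 := by
              rw [div_le_iff₀ (by linarith)]; nlinarith
            linarith
          have hβ0 : 0 < β := by linarith
          have hβne : (β : ℂ) ≠ 1 := by
            intro h; have := congrArg Complex.re h; simp at this; linarith
          have hζ : dedekindZeta₁ K β = 0 := by
            rw [dedekindZeta₁_apply_of_ne_one hβne, ← classGroupLFunction_one K hβne, hLβ, mul_zero]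
          refine ⟨β, hζ, hβ34, hβ1, fun x hx => ?_⟩
          have hMC : ∀ C : ClassGroup (𝓞 K),
              x - (((1 : ClassGroup (𝓞 K) →* ℂˣ) C : ℂ)).re * x ^ β / β = x - x ^ β / β := by
            intro C; simp
          exact chebyshevThetaIdeal_ge_of_classBound K (η := η) (x := x) (M := x - x ^ β / β)
            (fun C ↦ by have := (h2 x hx C).2; rwa [hMC] at this)
        · left
          intro x hx
          exact chebyshevThetaIdeal_ge_of_classBound_char K (η := η) hχ1 (fun C ↦ (h2 x hx C).2)
    · exact ⟨1, le_rfl, fun h => absurd h hm⟩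
  choose a ha hupa using hdeg
  set A : ℝ := ∑ m ∈ Finset.range (n + 1), a m with hA
  have haA : ∀ m ≤ n, a m ≤ A := fun m hm =>
    Finset.single_le_sum (f := a) (fun i _ => le_trans zero_le_one (ha i))
      (Finset.mem_range.mpr (Nat.lt_succ_of_le hm))
  have hA1 : 1 ≤ A := le_trans (ha 0) (haA 0 (Nat.zero_le n))
  refine ⟨A, hA1, fun F _ _ hF hFn => ?_⟩
  have hQ12 : (12 : ℝ) ≤ ThornerZaman.condQn F := ThornerZaman.twelve_le_condQn (K := F) hF
  have hQa : ∀ x : ℝ, ThornerZaman.condQn F ^ A ≤ x → ThornerZaman.condQn F ^ a (Module.finrank ℚ F) ≤ x :=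
    fun x hx => le_trans (Real.rpow_le_rpow_of_exponent_le (by linarith) (haA _ hFn)) hx
  rcases hupa _ hF F rfl with h1 | ⟨β, hζ, hβ34, hβ1, h2⟩
  · exact Or.inl fun x hx => h1 x (hQa x hx)
  · exact Or.inr ⟨β, hζ, hβ34, hβ1, fun x hx => h2 x (hQa x hx)⟩

/-- **The pointed prime ideal theorem, uniformly over the degrees `2 ≤ [F:ℚ] ≤ n`**: there are
`A ≥ 1`, `c > 0` such that for every such `F`, every real zero `β` of `ζ_F` with
`1 − c/(log|d_F| + log 4) < β < 1` and every `x ≥ Q_F^A`: `0 < x − x^β/β` and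
`|θ_F(x) − (x − x^β/β)| ≤ η (x − x^β/β)`.  Unconditional. [cite: ThornerZaman2019, Theorem 1.4] -/
theorem chebyshevThetaIdeal_pointed_of_le (n : ℕ) {η : ℝ} (hη : 0 < η) :
    ∃ A c : ℝ, 1 ≤ A ∧ 0 < c ∧ ∀ (F : Type) [Field F] [NumberField F], 1 < Module.finrank ℚ F →
      Module.finrank ℚ F ≤ n → ∀ β : ℝ, dedekindZeta₁ F β = 0 → 0 < β → β < 1 →
        1 - c / (Real.log ((NumberField.discr F).natAbs : ℝ) + Real.log 4) < β →
        ∀ x : ℝ, ThornerZaman.condQn F ^ A ≤ x →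
          0 < x - x ^ β / β ∧ |chebyshevThetaIdeal F x - (x - x ^ β / β)| ≤ η * (x - x ^ β / β) := by
  have hdeg : ∀ m : ℕ, ∃ a c : ℝ, 1 ≤ a ∧ 0 < c ∧ (1 < m → ∀ (K : Type) [Field K] [NumberField K],
      Module.finrank ℚ K = m → ∀ β : ℝ, dedekindZeta₁ K β = 0 → 0 < β → β < 1 →
        1 - c / (Real.log ((NumberField.discr K).natAbs : ℝ) + Real.log 4) < β →
        ∀ x : ℝ, ThornerZaman.condQn K ^ a ≤ x →
          0 < x - x ^ β / β ∧ |chebyshevThetaIdeal K x - (x - x ^ β / β)| ≤ η * (x - x ^ β / β)) := by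
    intro m
    by_cases hm : 1 < m
    · obtain ⟨a₂, c, ha₂, hc, h⟩ := chebyshevThetaIdeal_relative_at_realZero m hm hη
      exact ⟨a₂, c, ha₂, hc, fun _ => h⟩
    · exact ⟨1, 1, le_rfl, one_pos, fun h => absurd h hm⟩
  choose a c ha hc hP using hdeg
  set A : ℝ := ∑ m ∈ Finset.range (n + 1), a m with hA
  have haA : ∀ m ≤ n, a m ≤ A := fun m hm =>
    Finset.single_le_sum (f := a) (fun i _ => le_trans zero_le_one (ha i))
      (Finset.mem_range.mpr (Nat.lt_succ_of_le hm))
  have hA1 : 1 ≤ A := le_trans (ha 0) (haA 0 (Nat.zero_le n))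
  -- `c* = 1 / Σ_{m ≤ n} 1/c(m)` is `≤ c(m)` for every `m ≤ n`
  set S : ℝ := ∑ m ∈ Finset.range (n + 1), 1 / c m with hS
  have hS0 : 0 < S := Finset.sum_pos (fun i _ => by have := hc i; positivity)
    ⟨0, Finset.mem_range.mpr (Nat.succ_pos n)⟩
  have hcS : ∀ m ≤ n, 1 / S ≤ c m := by
    intro m hm
    have h1 : 1 / c m ≤ S := Finset.single_le_sum (f := fun i => 1 / c i)
      (fun i _ => by have := hc i; positivity) (Finset.mem_range.mpr (Nat.lt_succ_of_le hm))
    rw [div_le_iff₀ hS0]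
    have := mul_le_mul_of_nonneg_left h1 (hc m).le
    rw [mul_one_div_cancel (hc m).ne'] at this
    linarith [mul_comm (c m) S]
  refine ⟨A, 1 / S, hA1, by positivity, fun F _ _ hF hFn β hζ hβ0 hβ1 hβc x hx => ?_⟩
  have hQ12 : (12 : ℝ) ≤ ThornerZaman.condQn F := ThornerZaman.twelve_le_condQn (K := F) hF
  have hQa : ThornerZaman.condQn F ^ a (Module.finrank ℚ F) ≤ x :=
    le_trans (Real.rpow_le_rpow_of_exponent_le (by linarith) (haA _ hFn)) hx
  have hlog4 : 0 < Real.log 4 := Real.log_pos (by norm_num)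
  have hlogd : 0 ≤ Real.log ((NumberField.discr F).natAbs : ℝ) := Real.log_natCast_nonneg _
  have hβc' : 1 - c (Module.finrank ℚ F) / (Real.log ((NumberField.discr F).natAbs : ℝ) + Real.log 4) < β := by
    have := div_le_div_of_nonneg_right (hcS _ hFn) (by linarith : 0 ≤ Real.log ((NumberField.discr F).natAbs : ℝ) + Real.log 4)
    linarith
  exact hP _ hF F rfl β hζ hβ0 hβ1 hβc' x hQa

/-! ### The prime ideals of non-prime norm -/

/-- **`θ_F(x) − θ¹_F(x) ≤ x^{3/4}` for `x ≥ X₁(n)`, uniformly over the number fields of degree `≤ n`.** -/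
theorem chebyshevThetaIdeal_sub_degreeOneTheta_le_rpow (n : ℕ) :
    ∃ X₁ : ℝ, 1 ≤ X₁ ∧ ∀ (F : Type) [Field F] [NumberField F], Module.finrank ℚ F ≤ n →
      ∀ x : ℝ, X₁ ≤ x → chebyshevThetaIdeal F x - degreeOneTheta F x ≤ x ^ (3 / 4 : ℝ) := by
  -- `C = 4·3^n·(16(n+2))^{n+2}`; for `x ≥ max(e, C^8)`: `log x ≤ 16(n+2) x^{1/(16(n+2))}`, so
  -- `(log x/log 2 + 1)^k (log x/log 2)(2 √x log x) ≤ 4·3^n (log x)^{n+2} √x ≤ C x^{1/16} √x ≤ x^{3/4}`.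
  set C : ℝ := 4 * 3 ^ n * (16 * ((n : ℝ) + 2)) ^ (n + 2) with hC
  have hn0 : (0 : ℝ) ≤ n := Nat.cast_nonneg n
  have hC1 : 1 ≤ C := by
    rw [hC]
    have h3 : (1 : ℝ) ≤ 3 ^ n := one_le_pow₀ (by norm_num)
    have h16 : (1 : ℝ) ≤ (16 * ((n : ℝ) + 2)) ^ (n + 2) := one_le_pow₀ (by linarith)
    nlinarith
  have hC0 : 0 < C := by linarith
  refine ⟨max (Real.exp 1) (C ^ (16 : ℕ)), le_trans (by have := Real.add_one_le_exp (1:ℝ); linarith) (le_max_left _ _),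
    fun F _ _ hFn x hx => ?_⟩
  have hxe : Real.exp 1 ≤ x := le_trans (le_max_left _ _) hx
  have hxC : C ^ (16 : ℕ) ≤ x := le_trans (le_max_right _ _) hx
  have hx1 : 1 ≤ x := le_trans (by have := Real.add_one_le_exp (1:ℝ); linarith) hxe
  have hx0 : 0 < x := by linarith
  set ℓ : ℝ := Real.log x with hℓ
  have hℓ1 : 1 ≤ ℓ := by
    have := Real.log_le_log (Real.exp_pos 1) hxe
    rwa [Real.log_exp] at this
  have hl2 : Real.log 2 > 0.6931471803 := Real.log_two_gt_d9
  have hl2' : 0 < Real.log 2 := by linarith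
  have h1 : ℓ / Real.log 2 + 1 ≤ 3 * ℓ := by
    rw [div_add_one hl2'.ne', div_le_iff₀ hl2']; nlinarith
  have h2 : ℓ / Real.log 2 ≤ 2 * ℓ := by rw [div_le_iff₀ hl2']; nlinarith
  have hjunk := chebyshevThetaIdeal_sub_degreeOneTheta_le F hx1
  -- `(ℓ/log 2 + 1)^k (ℓ/log 2) (2√x ℓ) ≤ (3ℓ)^n (2ℓ)(2√x ℓ) = 4·3^n ℓ^{n+2} √x`
  have hk : (ℓ / Real.log 2 + 1) ^ Module.finrank ℚ F ≤ (3 * ℓ) ^ n := by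
    calc (ℓ / Real.log 2 + 1) ^ Module.finrank ℚ F ≤ (3 * ℓ) ^ Module.finrank ℚ F :=
          pow_le_pow_left₀ (by positivity) h1 _
      _ ≤ (3 * ℓ) ^ n := pow_le_pow_right₀ (by linarith) hFn
  have hsqrt0 : 0 ≤ Real.sqrt x := Real.sqrt_nonneg x
  have hB : (ℓ / Real.log 2 + 1) ^ Module.finrank ℚ F * (ℓ / Real.log 2) * (2 * Real.sqrt x * ℓ) ≤
      4 * 3 ^ n * ℓ ^ (n + 2) * Real.sqrt x := by
    calc (ℓ / Real.log 2 + 1) ^ Module.finrank ℚ F * (ℓ / Real.log 2) * (2 * Real.sqrt x * ℓ)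
        ≤ (3 * ℓ) ^ n * (2 * ℓ) * (2 * Real.sqrt x * ℓ) := by
          apply mul_le_mul (mul_le_mul hk h2 (by positivity) (by positivity)) le_rfl (by positivity)
            (by positivity)
      _ = 4 * 3 ^ n * ℓ ^ (n + 2) * Real.sqrt x := by rw [mul_pow]; ring
  -- `ℓ ≤ 16(n+2) x^{1/(16(n+2))}`, so `ℓ^{n+2} ≤ (16(n+2))^{n+2} x^{1/16}`
  have hε : (0 : ℝ) < 1 / (16 * ((n : ℝ) + 2)) := by positivity
  have hℓε : ℓ ≤ 16 * ((n : ℝ) + 2) * x ^ (1 / (16 * ((n : ℝ) + 2))) := by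
    have := Real.log_le_rpow_div hx0.le hε
    rw [← hℓ] at this
    have e : x ^ (1 / (16 * ((n : ℝ) + 2))) / (1 / (16 * ((n : ℝ) + 2))) =
        16 * ((n : ℝ) + 2) * x ^ (1 / (16 * ((n : ℝ) + 2))) := by field_simp
    linarith [e ▸ this]
  have hℓpow : ℓ ^ (n + 2) ≤ (16 * ((n : ℝ) + 2)) ^ (n + 2) * x ^ (1 / 16 : ℝ) := by
    calc ℓ ^ (n + 2) ≤ (16 * ((n : ℝ) + 2) * x ^ (1 / (16 * ((n : ℝ) + 2)))) ^ (n + 2) :=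
          pow_le_pow_left₀ (by linarith) hℓε _
      _ = (16 * ((n : ℝ) + 2)) ^ (n + 2) * (x ^ (1 / (16 * ((n : ℝ) + 2)))) ^ (n + 2) := mul_pow _ _ _
      _ = (16 * ((n : ℝ) + 2)) ^ (n + 2) * x ^ (1 / 16 : ℝ) := by
          have e : (x ^ (1 / (16 * ((n : ℝ) + 2)))) ^ (n + 2) = x ^ (1 / 16 : ℝ) := by
            rw [← Real.rpow_natCast, ← Real.rpow_mul hx0.le]
            congr 1
            push_cast
            field_simp
          rw [e]
  -- `C ≤ x^{1/16}` and `x^{1/16} x^{1/16} √x = x^{5/8} ≤ x^{3/4}`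
  have hx16 : C ≤ x ^ (1 / 16 : ℝ) := by
    have h := Real.rpow_le_rpow (by positivity) hxC (by norm_num : (0 : ℝ) ≤ 1 / 16)
    rwa [← Real.rpow_natCast, ← Real.rpow_mul hC0.le, show ((16 : ℕ) : ℝ) * (1 / 16 : ℝ) = 1 by norm_num,
      Real.rpow_one] at h
  have hsqrt : Real.sqrt x = x ^ (1 / 2 : ℝ) := Real.sqrt_eq_rpow x
  have hprod : x ^ (1 / 16 : ℝ) * x ^ (1 / 16 : ℝ) * Real.sqrt x = x ^ (5 / 8 : ℝ) := by
    rw [hsqrt, ← Real.rpow_add hx0, ← Real.rpow_add hx0]; norm_num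
  have h58 : x ^ (5 / 8 : ℝ) ≤ x ^ (3 / 4 : ℝ) := Real.rpow_le_rpow_of_exponent_le hx1 (by norm_num)
  have hx16' : 0 ≤ x ^ (1 / 16 : ℝ) := Real.rpow_nonneg hx0.le _
  calc chebyshevThetaIdeal F x - degreeOneTheta F x
      ≤ (ℓ / Real.log 2 + 1) ^ Module.finrank ℚ F * (ℓ / Real.log 2) * (2 * Real.sqrt x * ℓ) := hjunk
    _ ≤ 4 * 3 ^ n * ℓ ^ (n + 2) * Real.sqrt x := hB
    _ ≤ 4 * 3 ^ n * ((16 * ((n : ℝ) + 2)) ^ (n + 2) * x ^ (1 / 16 : ℝ)) * Real.sqrt x :=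
        mul_le_mul_of_nonneg_right (mul_le_mul_of_nonneg_left hℓpow (by positivity)) hsqrt0
    _ = C * x ^ (1 / 16 : ℝ) * Real.sqrt x := by rw [hC]; ring
    _ ≤ x ^ (1 / 16 : ℝ) * x ^ (1 / 16 : ℝ) * Real.sqrt x :=
        mul_le_mul_of_nonneg_right (mul_le_mul_of_nonneg_right hx16 hx16') hsqrt0
    _ = x ^ (5 / 8 : ℝ) := hprod
    _ ≤ x ^ (3 / 4 : ℝ) := h58

/-! ### A real zero outside the window contributes little -/

/-- **A zero outside the window is harmless**: for `c, η > 0` there is `L₀` such that for `d ≥ 3`,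
`L ≥ L₀`, `1/2 ≤ β ≤ 1 − c/(log d + log 4)`: `(d^L)^β/β ≤ η d^L`. -/
theorem rpow_div_le_of_le_window {c η : ℝ} (hc : 0 < c) (hη : 0 < η) :
    ∃ L₀ : ℝ, 0 < L₀ ∧ ∀ d : ℝ, 3 ≤ d → ∀ L : ℝ, L₀ ≤ L → ∀ β : ℝ, 1 / 2 ≤ β →
      β ≤ 1 - c / (Real.log d + Real.log 4) → (d ^ L) ^ β / β ≤ η * d ^ L := by
  set L₀ : ℝ := max 1 (3 * Real.log (2 / η) / c) with hL₀
  refine ⟨L₀, lt_of_lt_of_le one_pos (le_max_left _ _), fun d hd L hL β hβ hβc => ?_⟩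
  have hd0 : 0 < d := by linarith
  have hlogd : 1 < Real.log d := by
    have h3 : 1 < Real.log 3 := by
      have h23 : Real.log 2 * (3 / 2) ≤ Real.log 3 := by
        have := Real.log_le_log (by norm_num : (0:ℝ) < 2 ^ (3:ℕ)) (by norm_num : (2:ℝ) ^ (3:ℕ) ≤ 3 ^ (2:ℕ))
        rw [Real.log_pow, Real.log_pow] at this
        push_cast at this
        linarith
      have := Real.log_two_gt_d9
      linarith
    exact lt_of_lt_of_le h3 (Real.log_le_log (by norm_num) hd)
  have hlog4 : Real.log 4 ≤ 2 * Real.log d := by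
    rw [show (4:ℝ) = 2 ^ 2 by norm_num, Real.log_pow]; push_cast
    have h23 : Real.log 2 ≤ Real.log 3 := Real.log_le_log (by norm_num) (by norm_num)
    have h3d : Real.log 3 ≤ Real.log d := Real.log_le_log (by norm_num) hd
    linarith
  set x : ℝ := d ^ L with hx
  have hx0 : 0 < x := Real.rpow_pos_of_pos hd0 L
  have hL1 : 1 ≤ L := le_trans (le_max_left _ _) hL
  have hβ0 : 0 < β := by linarith
  -- `x^β/β ≤ 2 x^β = 2 x · x^{β−1} ≤ 2 x · e^{−c L/3}`
  have h1 : x ^ β / β ≤ 2 * x ^ β := by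
    rw [div_le_iff₀ hβ0]
    have := Real.rpow_nonneg hx0.le β
    nlinarith
  have hexp : x ^ β = x * Real.exp ((β - 1) * (L * Real.log d)) := by
    have : x ^ β = x ^ (1 : ℝ) * x ^ (β - 1) := by rw [← Real.rpow_add hx0]; ring_nf
    rw [this, Real.rpow_one, Real.rpow_def_of_pos hx0, hx, Real.log_rpow hd0]
    ring_nf
  have hdecay : (β - 1) * (L * Real.log d) ≤ -(c * L / 3) := by
    have hlog4pos : 0 < Real.log 4 := Real.log_pos (by norm_num)
    have hden : 0 < Real.log d + Real.log 4 := by linarith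
    have h2 : c / (Real.log d + Real.log 4) * Real.log d ≥ c / 3 := by
      rw [ge_iff_le, div_mul_eq_mul_div, le_div_iff₀ hden]
      nlinarith
    have h3 : (1 - β) * (L * Real.log d) ≥ c / (Real.log d + Real.log 4) * Real.log d * L := by
      have := mul_le_mul_of_nonneg_right (show c / (Real.log d + Real.log 4) ≤ 1 - β by linarith)
        (show 0 ≤ L * Real.log d by positivity)
      linarith [this]
    nlinarith
  have hexp2 : Real.exp ((β - 1) * (L * Real.log d)) ≤ η / 2 := by
    calc Real.exp ((β - 1) * (L * Real.log d)) ≤ Real.exp (-(c * L / 3)) := Real.exp_le_exp.mpr hdecay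
      _ ≤ Real.exp (-(c * L₀ / 3)) := Real.exp_le_exp.mpr (by nlinarith)
      _ ≤ Real.exp (-(Real.log (2 / η))) := by
          apply Real.exp_le_exp.mpr
          have : 3 * Real.log (2 / η) / c ≤ L₀ := le_max_right _ _
          rw [div_le_iff₀ hc] at this
          linarith
      _ = η / 2 := by rw [Real.exp_neg, Real.exp_log (by positivity)]; field_simp
  calc x ^ β / β ≤ 2 * x ^ β := h1
    _ = 2 * x * Real.exp ((β - 1) * (L * Real.log d)) := by rw [hexp]; ring
    _ ≤ 2 * x * (η / 2) := mul_le_mul_of_nonneg_left hexp2 (by positivity)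
    _ = η * x := by ring

/-! ### The degree-one subfield -/

section DegreeOne

variable {N : Type} [Field N] [NumberField N] [IsGalois ℚ N]

/-- **The subfield of degree one**: if `H` is all of `Gal(N/ℚ)` then every prime `p ∤ d_N` has exactly
one prime of `N^H` above it, of degree one (Perlis' dictionary), so
`θ¹_{N^H}(x) ≥ θ(x) − log|d_N|`. -/
theorem degreeOneTheta_fixedField_ge_of_forall_mem (H : Subgroup (N ≃ₐ[ℚ] N)) (hH : ∀ g, g ∈ H)
    (x : ℝ) :
    Chebyshev.theta x - Real.log ((NumberField.discr N).natAbs : ℝ) ≤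
      degreeOneTheta (IntermediateField.fixedField H) x := by
  classical
  have hHtop : H = ⊤ := (Subgroup.eq_top_iff' H).mpr hH
  -- at `p ∤ d_N`: `a_{N^H}(p) = 1`
  have hcount : ∀ p : ℕ, p.Prime → ¬ ((p : ℤ) ∣ NumberField.discr N) →
      (splittingType (IntermediateField.fixedField H) p).count 1 = 1 := by
    intro p hp hd
    obtain ⟨Q₀, hQ₀max, hQ₀over, ⟨φ, hφ⟩, hI⟩ := exists_isArithFrobAt_of_not_dvd_discr (N := N) hp hd
    have hk := card_fixingSubgroup_mul_count_one_splittingType (IntermediateField.fixedField H) hp Q₀ hφ hI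
    rw [natCard_fixingSubgroup_fixedField] at hk
    simp only [IntermediateField.fixingSubgroup_fixedField] at hk
    have hall : Nat.card {g : N ≃ₐ[ℚ] N // g * φ * g⁻¹ ∈ H} = Nat.card (N ≃ₐ[ℚ] N) := by
      rw [Nat.card_congr (Equiv.subtypeUnivEquiv fun g => hH (g * φ * g⁻¹))]
    have hHcard : Nat.card H = Nat.card (N ≃ₐ[ℚ] N) := by rw [hHtop, Subgroup.card_top]
    rw [hall, ← hHcard] at hk
    have hpos : 0 < Nat.card H := Nat.card_pos
    have : Nat.card H * (splittingType (IntermediateField.fixedField H) p).count 1 = Nat.card H * 1 := by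
      rw [mul_one]; exact hk
    exact Nat.eq_of_mul_eq_mul_left hpos this
  rw [degreeOneTheta_eq_sum_count_one, Chebyshev.theta_eq_sum_primesLE]
  have hram := sum_primesLE_filter_dvd_discr_log_le N ⌊x⌋₊
  rw [Finset.sum_filter] at hram
  have hpt : ∀ p ∈ Nat.primesLE ⌊x⌋₊, Real.log p - (if (p : ℤ) ∣ NumberField.discr N then Real.log p else 0) ≤
      (((splittingType (IntermediateField.fixedField H) p).count 1 : ℕ) : ℝ) * Real.log p := by
    intro p hp
    have hp' := (Nat.mem_primesLE.mp hp).2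
    have hlog : 0 ≤ Real.log p := Real.log_natCast_nonneg p
    by_cases hd : (p : ℤ) ∣ NumberField.discr N
    · rw [if_pos hd, sub_self]; positivity
    · rw [if_neg hd, sub_zero, hcount p hp' hd, Nat.cast_one, one_mul]
  have := Finset.sum_le_sum hpt
  rw [Finset.sum_sub_distrib] at this
  linarith

end DegreeOne

end Summit.QuantumAdvantage.QuantumAdvantage.Theorems.DegreeOnePrimesEscape

end
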